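import Summits.QuantumAdvantage.QuantumAdvantage.Theorems.CubicForrelationNearExactIsExactCensusAffineD
import Summits.QuantumAdvantage.QuantumAdvantage.Theorems.CubicForrelationNearExactIsExactMismatchBudget
import Summits.QuantumAdvantage.QuantumAdvantage.Theorems.CubicForrelationNearExactIsExactQuadWalshPlateau

/-!
# Crux `CubicForrelation.NearExactIsExact` (stmt-QuantumAdvantage-14043): the `n = 10`, `θ = 7/8` census —
  Walsh bookkeeping of the normal form (part A of the discharge of CENSUS₁₀′)

Block-2b certificate seat `b2b-cforr-cert` (2026-08-18).  HONEST FRAMING: the value here is a THEOREM about the finite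
slice `n = 10` of the crux (the hypothesis CENSUS₁₀′ of `isolation_ten_78_of_census2` is being DISCHARGED by proof,
part B), NOT summit progress.

Setting: `E` cubic, `D`, `Q` quadratic on 8 bits, `bh : Bool`, the normal form `g(w ‖ a ‖ b) = E w ⊕ aD w ⊕ bQ w`, the
cell sums `S_{a,β}(ξ) = Σ_{D w = a, Q w = β} (−1)^{E w + w·ξ}`, and integer functions `p, v` on 9 bits with
`S_{a,bh}(ξ) = 8 p(ξ ‖ a)` (heavy) and `S_{a,¬bh}(ξ) = 4 v(ξ ‖ a)` (light).  Contents: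
* `nf10_W_heavy` / `nf10_W_light`: `W_g(z ‖ bh) = 32 p(z)`, `W_g(z ‖ ¬bh) = 16 v(z)` (`stub_cellDecomposition`);
* `nf10_heavy_budget`: if `Φ(f₁,g) > 7/8` for a partner `f₁` and `v` is odd, then `Σ_z (p z − (−1)^{f₁(z ‖ bh)})² < 128`
  (cost identity `Σ_x (W_g − 32(−1)^{f₁})² = 2²¹(1 − Φ)`, and the light terms are `≥ 256` each);
* `nf10_W_p`: the 9-bit Fourier transform of `p` is `32·(−1)^{E w ⊕ aD w}·[Q w = bh]` at `w ‖ a`;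
* `nf10_sum_p_sq`: `Σ_z p(z)² = 4·#{w : Q w = bh}`; `nf10_sum_signOf_Q`: `Σ_w (−1)^{Q w} = (−1)^{bh}(2#{Q = bh} − 256)`;
* `nf10_quad_bias_sq`: `(Σ_w (−1)^{Q w})² ∉ {576, 1600}` for quadratic `Q` (`stub_quadWalshPlateau`: it is `0` or `4^s`);
* small generic tools: Fourier inversion `nf10_sum_twist_mul_W`, `|W_h| ≤ Σ|h|`, parities.
Sources: R. O'Donnell, *Analysis of Boolean Functions* (2014) §1.4; S. Aaronson, A. Ambainis, SIAM J. Comput. 47 (2018)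
§1.1.1; MacWilliams–Sloane Ch. 15 (quadratic forms).  Axioms: the standard three.
-/

set_option linter.dupNamespace false -- D-0017: single-problem summit ⇒ `QuantumAdvantage.QuantumAdvantage` by design

noncomputable section

namespace Summit.QuantumAdvantage.QuantumAdvantage.Theorems.CubicForrelation.NearExactIsExact

open Finset
open Literature.Computability.QuantumComplexity
open Literature.Computability.QuantumComplexity.BuzetChailloux (signOf_sq)
open Literature.Computability.QuantumComplexity.DerivativeWalsh (W sum_W_sq)
open Literature.Computability.QuantumComplexity.Simon (twist_xor_left sum_twist twist_eq_one_or)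

/-! ### Generic tools -/

/-- Fourier inversion on `𝔽₂ⁿ`: `Σ_x (−1)^{u·x} W_h(x) = 2ⁿ h(u)`. [cite: ODonnell2014, §1.4] -/
theorem nf10_sum_twist_mul_W {n : ℕ} (h : (Fin n → Bool) → ℝ) (u : Fin n → Bool) :
    ∑ x, twist u x * W h x = (2 : ℝ) ^ n * h u := by
  have step : ∀ x : Fin n → Bool, twist u x * W h x = ∑ y, h y * twist (fun i => u i ^^ y i) x := by
    intro x
    rw [W, mul_sum]
    refine sum_congr rfl fun y _ => ?_
    rw [twist_xor_left]
    ring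
  rw [sum_congr rfl fun x _ => step x, sum_comm]
  have key : ∀ y : Fin n → Bool, ((fun i => u i ^^ y i) = fun _ => false) ↔ y = u := by
    intro y
    constructor
    · intro hxy
      funext i
      have hi : (u i ^^ y i) = false := congrFun hxy i
      revert hi
      cases u i <;> cases y i <;> simp
    · rintro rfl
      funext i
      exact Bool.xor_self _
  have inner : ∀ y : Fin n → Bool,
      ∑ x, h y * twist (fun i => u i ^^ y i) x = h y * (if y = u then (2 : ℝ) ^ n else 0) := by
    intro y
    rw [← mul_sum, sum_twist]
    congr 1
    exact if_congr (key y) rfl rfl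
  rw [sum_congr rfl fun y _ => inner y]
  simp_rw [mul_ite, mul_zero, Finset.sum_ite_eq' univ, if_pos (mem_univ _)]
  ring

/-- `|W_h(y)| ≤ Σ_x |h(x)|` (every character value is `±1`). [cite: ODonnell2014, §1.4] -/
theorem nf10_abs_W_le {n : ℕ} (h : (Fin n → Bool) → ℝ) (y : Fin n → Bool) : |W h y| ≤ ∑ x, |h x| := by
  unfold W
  refine (abs_sum_le_sum_abs _ _).trans (le_of_eq (sum_congr rfl fun x _ => ?_))
  rw [abs_mul, abs_twist, mul_one]

/-- For an even integer `e`, `|e| ≤ e²/2`, i.e. `2|e| ≤ e²`. [folklore] -/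
theorem nf10_two_abs_le_sq (e : ℤ) (he : Even e) : 2 * |e| ≤ e ^ 2 := by
  obtain ⟨m, rfl⟩ := he
  rcases le_or_gt 0 m with hm | hm
  · rw [abs_of_nonneg (by omega)]
    rcases (show m = 0 ∨ 1 ≤ m by omega) with h0 | h1
    · subst h0; norm_num
    · nlinarith
  · rw [abs_of_neg (by omega)]
    nlinarith

/-- For an integer `k`: `k ≤ k²` and `−k ≤ k²`. [folklore] -/
theorem nf10_le_sq (k : ℤ) : k ≤ k ^ 2 ∧ -k ≤ k ^ 2 := by
  constructor <;> nlinarith [sq_nonneg (k - 1), sq_nonneg (k + 1)]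

/-- Parity of a sum: `[a + b odd] = [a odd] ⊕ [b odd]`. [folklore] -/
theorem nf10_decide_odd_add (a b : ℤ) : decide (Odd (a + b)) = (decide (Odd a) ^^ decide (Odd b)) := by
  rcases Int.even_or_odd a with ha | ha <;> rcases Int.even_or_odd b with hb | hb
  · have : ¬ Odd (a + b) := Int.not_odd_iff_even.2 (ha.add hb)
    simp [this, Int.not_odd_iff_even.2 ha, Int.not_odd_iff_even.2 hb]
  · have : Odd (a + b) := ha.add_odd hb
    simp [this, Int.not_odd_iff_even.2 ha, hb]
  · have : Odd (a + b) := ha.add_even hb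
    simp [this, ha, Int.not_odd_iff_even.2 hb]
  · have : ¬ Odd (a + b) := Int.not_odd_iff_even.2 (ha.add_odd hb)
    simp [this, ha, hb]

/-- Parity is insensitive to sign. [folklore] -/
theorem nf10_decide_odd_neg (a : ℤ) : decide (Odd (-a)) = decide (Odd a) := by
  by_cases h : Odd a
  · simp [h, Odd.neg h]
  · have h' : ¬ Odd (-a) := fun h2 => h (by simpa using Odd.neg h2)
    simp [h, h']

/-! ### The normal form: Walsh transform on the two halves -/

section NormalForm

variable (E D Q : (Fin (4 + 4) → Bool) → Bool) (bh : Bool) (g : (Fin (4 + 4 + 1 + 1) → Bool) → Bool)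
  (p v : (Fin (4 + 4 + 1) → Bool) → ℤ)

/-- **Heavy half.** If `g(w ‖ a₀ ‖ b₀) = E w ⊕ a₀D w ⊕ b₀Q w` and the heavy cell sums are `S_{a,bh}(ξ) = 8 p(ξ ‖ a)`,
then `W_g(z ‖ bh) = 32 p(z)` for every `z ∈ 𝔽₂⁹`. [`stub_cellDecomposition`] -/
theorem nf10_W_heavy
    (hshape : ∀ (w : Fin (4 + 4) → Bool) (a₀ b₀ : Bool),
      g (Fin.snoc (Fin.snoc w a₀) b₀) = (E w ^^ (a₀ && D w) ^^ (b₀ && (Q w ^^ false))))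
    (hp : ∀ (ξ : Fin (4 + 4) → Bool) (a : Bool),
      (∑ w : Fin (4 + 4) → Bool, if (D w = a ∧ Q w = bh) then signOf (E w) * twist w ξ else 0) =
        8 * (p (Fin.snoc ξ a) : ℝ))
    (z : Fin (4 + 4 + 1) → Bool) : W (fun y => signOf (g y)) (Fin.snoc z bh) = 32 * (p z : ℝ) := by
  have hz : z = Fin.snoc (Fin.init z) (z (Fin.last _)) := (Fin.snoc_init_self z).symm
  rw [hz, stub_cellDecomposition E D Q false g hshape, tuc_cellsum_def, hp]
  ring

/-- **Light half.** With light cell sums `S_{a,¬bh}(ξ) = 4 v(ξ ‖ a)`: `W_g(z ‖ ¬bh) = 16 v(z)`. [`stub_cellDecomposition`] -/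
theorem nf10_W_light
    (hshape : ∀ (w : Fin (4 + 4) → Bool) (a₀ b₀ : Bool),
      g (Fin.snoc (Fin.snoc w a₀) b₀) = (E w ^^ (a₀ && D w) ^^ (b₀ && (Q w ^^ false))))
    (hv : ∀ (ξ : Fin (4 + 4) → Bool) (a : Bool),
      (∑ w : Fin (4 + 4) → Bool, if (D w = a ∧ Q w = !bh) then signOf (E w) * twist w ξ else 0) =
        4 * (v (Fin.snoc ξ a) : ℝ))
    (z : Fin (4 + 4 + 1) → Bool) : W (fun y => signOf (g y)) (Fin.snoc z (!bh)) = 16 * (v z : ℝ) := by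
  have hz : z = Fin.snoc (Fin.init z) (z (Fin.last _)) := (Fin.snoc_init_self z).symm
  rw [hz, stub_cellDecomposition E D Q false g hshape, tuc_cellsum_def, hv]
  ring

/-- **Heavy budget.** In the window `Φ(f₁,g) > 7/8`, with `W_g(z ‖ bh) = 32 p(z)` and `W_g(z ‖ ¬bh) = 16 v(z)`, `v` odd:
`Σ_z (p z − (−1)^{f₁(z ‖ bh)})² < 128`.  (Cost identity `Σ_x (W_g(x) − 32(−1)^{f₁ x})² = 2²⁰ − 64·2¹⁵Φ + 2²⁰
= 2²¹(1 − Φ) < 2¹⁸`; each light term `(16v − 32s)² = 256(v − 2s)² ≥ 256`.) [cite: AaronsonAmbainis2018, §1.1.1] -/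
theorem nf10_heavy_budget (f₁ : (Fin (4 + 4 + 1 + 1) → Bool) → Bool) (hΦ : 7 / 8 < forrelation f₁ g)
    (hWh : ∀ z, W (fun y => signOf (g y)) (Fin.snoc z bh) = 32 * (p z : ℝ))
    (hWl : ∀ z, W (fun y => signOf (g y)) (Fin.snoc z (!bh)) = 16 * (v z : ℝ)) (hvodd : ∀ z, Odd (v z)) :
    ∑ z : Fin (4 + 4 + 1) → Bool, ((p z : ℝ) - signOf (f₁ (Fin.snoc z bh))) ^ 2 < 128 := by
  -- the forrelation as a correlation with the Walsh transform, split along the last coordinate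
  have hF : ∑ x, signOf (f₁ x) * W (fun y => signOf (g y)) x = (2 : ℝ) ^ 15 * forrelation f₁ g := by
    have h := vg_two_pow_mul_forrelation (m := 5) f₁ g
    norm_num at h ⊢
    exact h.symm
  have hFs := tb_sum_snoc (fun x => signOf (f₁ x) * W (fun y => signOf (g y)) x)
  rw [hF] at hFs
  simp only [mb_sum_bool _ bh, hWh, hWl] at hFs
  -- Parseval, split along the last coordinate
  have hP : ∑ x, W (fun y => signOf (g y)) x ^ 2 = (2 : ℝ) ^ 20 := by
    rw [sum_W_sq]
    simp only [signOf_sq, Finset.sum_const, Finset.card_univ, Fintype.card_fun, Fintype.card_bool,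
      Fintype.card_fin, nsmul_eq_mul, mul_one]
    norm_num
  have hPs := tb_sum_snoc (fun x => W (fun y => signOf (g y)) x ^ 2)
  rw [hP] at hPs
  simp only [mb_sum_bool _ bh, hWh, hWl] at hPs
  -- pointwise: heavy square expanded, light square bounded below
  have hpt : ∀ z : Fin (4 + 4 + 1) → Bool,
      1024 * ((p z : ℝ) - signOf (f₁ (Fin.snoc z bh))) ^ 2 + 256 ≤
        (32 * (p z : ℝ)) ^ 2 + (16 * (v z : ℝ)) ^ 2 + 2048
          - 64 * (signOf (f₁ (Fin.snoc z bh)) * (32 * (p z : ℝ)) + signOf (f₁ (Fin.snoc z (!bh))) * (16 * (v z : ℝ))) := by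
    intro z
    have h1 := tb_one_le_sq_odd_sub (v z) (hvodd z) (f₁ (Fin.snoc z (!bh)))
    have hs1 : signOf (f₁ (Fin.snoc z bh)) ^ 2 = 1 := signOf_sq _
    have hs2 : signOf (f₁ (Fin.snoc z (!bh))) ^ 2 = 1 := signOf_sq _
    nlinarith [hs1, hs2, h1]
  have hsum := Finset.sum_le_sum fun z (_ : z ∈ (univ : Finset (Fin (4 + 4 + 1) → Bool))) => hpt z
  simp only [Finset.sum_add_distrib, Finset.sum_sub_distrib, ← Finset.mul_sum, Finset.sum_const, Finset.card_univ,
    Fintype.card_fun, Fintype.card_bool, Fintype.card_fin, nsmul_eq_mul] at hsum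
  simp only [Finset.sum_add_distrib] at hPs hFs
  norm_num at hsum hPs hFs ⊢
  linarith

/-- **The Fourier transform of the heavy quotient `p`.** With `S_{a,bh}(ξ) = 8 p(ξ ‖ a)`:
`Σ_z p(z) (−1)^{z·(w ‖ a)} = 32 · [Q w = bh] · (−1)^{E w ⊕ aD w}` (Fourier inversion on `𝔽₂⁸`, then the two-point
sum over the ninth coordinate). [cite: ODonnell2014, §1.4] -/
theorem nf10_W_p
    (hp : ∀ (ξ : Fin (4 + 4) → Bool) (a : Bool),
      (∑ w : Fin (4 + 4) → Bool, if (D w = a ∧ Q w = bh) then signOf (E w) * twist w ξ else 0) =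
        8 * (p (Fin.snoc ξ a) : ℝ))
    (y : Fin (4 + 4 + 1) → Bool) :
    W (fun z => (p z : ℝ)) y =
      32 * (if Q (Fin.init y) = bh then signOf (E (Fin.init y) ^^ (y (Fin.last _) && D (Fin.init y))) else 0) := by
  have hy : y = Fin.snoc (Fin.init y) (y (Fin.last _)) := (Fin.snoc_init_self y).symm
  set w := Fin.init y with hw
  set a := y (Fin.last _) with ha
  -- the cell indicator functions on 8 bits
  have hcell : ∀ (α : Bool) (ξ : Fin (4 + 4) → Bool),
      W (fun w' => if (D w' = α ∧ Q w' = bh) then signOf (E w') else 0) ξ = 8 * (p (Fin.snoc ξ α) : ℝ) := by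
    intro α ξ
    rw [← hp ξ α, W]
    refine sum_congr rfl fun w' _ => ?_
    split_ifs <;> simp
  unfold W
  conv_lhs => rw [hy]
  rw [tb_sum_snoc]
  simp only [twist_snoc]
  have hinner : ∀ ξ : Fin (4 + 4) → Bool, ∑ b : Bool, (p (Fin.snoc ξ b) : ℝ) * (twist ξ w * signOf (b && a)) =
      (1 / 8) * ∑ b : Bool, signOf (b && a) *
        (twist w ξ * W (fun w' => if (D w' = b ∧ Q w' = bh) then signOf (E w') else 0) ξ) := by
    intro ξ
    rw [mul_sum]
    refine sum_congr rfl fun b _ => ?_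
    rw [hcell, twist_comm ξ w]
    ring
  rw [sum_congr rfl fun ξ _ => hinner ξ, ← mul_sum, sum_comm]
  simp only [← mul_sum, nf10_sum_twist_mul_W]
  rw [Fintype.sum_bool]
  cases hE : E w <;> cases hD : D w <;> cases hQ : Q w <;> cases a <;> cases bh <;> norm_num [signOf, hE, hD, hQ]

/-- **Energy of `p`.** `Σ_z p(z)² = 4 · #{w : Q w = bh}` (Parseval per heavy cell: `Σ_ξ S_{a,bh}(ξ)² = 256·|cell|`).
[cite: ODonnell2014, §1.4] -/
theorem nf10_sum_p_sq
    (hp : ∀ (ξ : Fin (4 + 4) → Bool) (a : Bool),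
      (∑ w : Fin (4 + 4) → Bool, if (D w = a ∧ Q w = bh) then signOf (E w) * twist w ξ else 0) =
        8 * (p (Fin.snoc ξ a) : ℝ)) :
    ∑ z : Fin (4 + 4 + 1) → Bool, ((p z : ℝ)) ^ 2 =
      4 * ∑ w : Fin (4 + 4) → Bool, (if Q w = bh then (1 : ℝ) else 0) := by
  have hcell : ∀ (α : Bool) (ξ : Fin (4 + 4) → Bool),
      W (fun w' => if (D w' = α ∧ Q w' = bh) then signOf (E w') else 0) ξ = 8 * (p (Fin.snoc ξ α) : ℝ) := by
    intro α ξ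
    rw [← hp ξ α, W]
    refine sum_congr rfl fun w' _ => ?_
    split_ifs <;> simp
  have hpar : ∀ α : Bool, ∑ ξ : Fin (4 + 4) → Bool, (8 * (p (Fin.snoc ξ α) : ℝ)) ^ 2 =
      256 * ∑ w' : Fin (4 + 4) → Bool, (if (D w' = α ∧ Q w' = bh) then (1 : ℝ) else 0) := by
    intro α
    rw [sum_congr rfl fun ξ _ => by rw [← hcell α ξ], sum_W_sq, show (2 : ℝ) ^ (4 + 4) = 256 by norm_num]
    congr 1
    refine sum_congr rfl fun w' _ => ?_
    split_ifs
    · exact signOf_sq _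
    · simp
  rw [tb_sum_snoc]
  rw [sum_comm]
  have h64 : ∀ α : Bool, ∑ ξ : Fin (4 + 4) → Bool, ((p (Fin.snoc ξ α) : ℝ)) ^ 2 =
      4 * ∑ w' : Fin (4 + 4) → Bool, (if (D w' = α ∧ Q w' = bh) then (1 : ℝ) else 0) := by
    intro α
    have := hpar α
    have h' : ∑ ξ : Fin (4 + 4) → Bool, (8 * (p (Fin.snoc ξ α) : ℝ)) ^ 2 =
        64 * ∑ ξ : Fin (4 + 4) → Bool, ((p (Fin.snoc ξ α) : ℝ)) ^ 2 := by
      rw [mul_sum]; exact sum_congr rfl fun ξ _ => by ring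
    linarith
  rw [Fintype.sum_bool, h64, h64, ← mul_add, ← sum_add_distrib]
  congr 1
  refine sum_congr rfl fun w' _ => ?_
  cases D w' <;> cases Q w' <;> cases bh <;> simp

/-- `Σ_w (−1)^{Q w} = (−1)^{bh} · (2·#{w : Q w = bh} − 256)` on 8 bits. [folklore] -/
theorem nf10_sum_signOf_Q :
    ∑ w : Fin (4 + 4) → Bool, signOf (Q w) =
      signOf bh * (2 * ∑ w : Fin (4 + 4) → Bool, (if Q w = bh then (1 : ℝ) else 0) - 256) := by
  have hpt : ∀ w : Fin (4 + 4) → Bool, signOf (Q w) = signOf bh * (2 * (if Q w = bh then (1 : ℝ) else 0) - 1) := by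
    intro w; cases Q w <;> cases bh <;> norm_num [signOf]
  rw [sum_congr rfl fun w _ => hpt w, ← mul_sum, sum_sub_distrib, ← mul_sum]
  simp only [sum_const, card_univ, Fintype.card_fun, Fintype.card_bool, Fintype.card_fin, nsmul_eq_mul, mul_one]
  norm_num

/-- **Quadratic bias.** For quadratic `Q` on 8 bits, `(Σ_w (−1)^{Q w})²` is `0` or a power of `4`
(`stub_quadWalshPlateau` at the zero frequency); in particular it is neither `576 = 24²` nor `1600 = 40²`.
[cite: MacWilliamsSloane1977, Ch. 15 Thm 5] -/
theorem nf10_quad_bias_sq (hQ : IsDegLeFun 2 Q) :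
    (∑ w : Fin (4 + 4) → Bool, signOf (Q w)) ^ 2 ≠ 576 ∧ (∑ w : Fin (4 + 4) → Bool, signOf (Q w)) ^ 2 ≠ 1600 := by
  obtain ⟨s, hs⟩ := stub_quadWalshPlateau (4 + 4) Q hQ
  have h0 : W (fun x => signOf (Q x)) (fun _ => false) = ∑ w, signOf (Q w) := by
    unfold W
    exact sum_congr rfl fun w _ => by rw [twist_zero_right, mul_one]
  have h4 : ∀ s : ℕ, (4 : ℝ) ^ s ≠ 576 ∧ (4 : ℝ) ^ s ≠ 1600 := by
    intro s
    rcases le_or_gt s 4 with h | h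
    · have : (4 : ℝ) ^ s ≤ 4 ^ 4 := pow_le_pow_right₀ (by norm_num) h
      constructor <;> (intro he; rw [he] at this; norm_num at this)
    · rcases le_or_gt s 5 with h5 | h5
      · have : s = 5 := by omega
        subst this; norm_num
      · have : (4 : ℝ) ^ 6 ≤ 4 ^ s := pow_le_pow_right₀ (by norm_num) h5
        constructor <;> (intro he; rw [he] at this; norm_num at this)
  rcases hs (fun _ => false) with hz | hsq
  · rw [h0] at hz; rw [hz]; norm_num
  · rw [h0] at hsq; rw [hsq]; exact h4 s

end NormalForm

end Summit.QuantumAdvantage.QuantumAdvantage.Theorems.CubicForrelation.NearExactIsExact
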